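import Summits.HodgeConjecture.HodgeConjecture.Theorems.F0P6aFrobeniusTwistIdealAtSplitPlace   -- ★ p847929 (LA4-p03): rows for the type product of ANY CM type `Φ ∋ τ_w`
import HarnessLib

/-!
# Crux `HLiu418` — P6 sub-line **F0-P6a**: the canonical twist ideal `𝔞_can(m, τR, w)` IS the type product of the CM type `Φ′(m)`
# (dictionary between the L3 `stub_FROB` token and the L4 `stub_TWIST` ∕ E-export rows)

Cell `hodgecm-mathlib`, crux `stmt-HodgeConjecture-24832` (hLiu418), sub-line P6a; «L4» LA4-p03 (g0), LA4-plan (g0) ruling 02:30:51Z («(ii) IS RIGHT»)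
+ DEAL «organ #4 = the DICTIONARY LEMMA» (`--supports stmt-HodgeConjecture-24832 --as helper`, count-neutral).  THEOREMS ONLY (no definition, no instance,
no notation, no named fact, no `sorry`).  HC_CM is proved only modulo the printed citations (2 remaining named inputs hLiu418 24832, h413 24833) until
rung 0 closes; nothing here is about HC.

THE JUNCTION.  The D-line ∕ L3 road pins the twist ideal of a Frobenius-reading `γ_σ` to the TOKEN (★ LA3-p03 p847883 (ρ0), GEN F-PIN-can, v6g
`twistIdeal_frob_eq`) `𝔞_can(m, τR, w) := ∏ τ ∈ univ.filter (m τ ≠ 0 ∧ ker (residue ∘ τR τ) ≠ 𝔭_{c•w}), ker (residue ∘ τR τ)` — the Shimura–Taniyama ideal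
of an `𝒪_F`-object of Lie signature `m` at the `q = p^{f_w}`-Frobenius, each embedding counted once, off the `c•w`-block ([Shimura1998] §13.1 Thm. 1 and (7)).
The E-side rows (a)(b)(c)(FROB-𝔞) of `ETwistAt` ∕ `PELTwistLawAt` are paid by ★ p847929 `exists_frobeniusTwistIdeal` for the type product `∏_{τ ∈ Φ} 𝔭_τ` of
ANY CM type `Φ` of embeddings `F → F̄_w` through the structural `τ_w`.  THIS FILE: the index set **`Φ′(m) := {τ | m τ ≠ 0 ∧ τ ∤ c•w}` IS such a CM type**
(§1: `τ ∈ Φ′ ↔ τ∘c ∉ Φ′`, `τ_w ∈ Φ′`), under the signature laws of the spine ED. 4 ∕ v6g (G3): `hpair` (`m τ + m (τ∘c) = 2`), `hcount` (`∑_{τ ↦ c•w} m τ = 1`),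
`hone` (banal law: `m τ = 1` only at embeddings inducing `w` or `c•w`), `hw : c•w ≠ w` — so `𝔞_can(m, τR, w) = ∏_{τ ∈ Φ′(m)} 𝔭_τ` is LITERALLY a type product
and the rows follow by ONE application of ★ p847929 (§2), in the hypothesis spelling of the P-line (`hpChar : p.Prime ∧ p ∈ 𝔭_w`, `hfDeg`, `¬ p ∣ N`).  With the
adapted frame `Φ_w` and `m := mOf ι₁ Φ_w (σ₀ ∘ ·)` (`m = 0` on `Φ_w` off the pair), `Φ′(m) = (Φ_wᶜ ∖ {τ_w∘c}) ∪ {τ_w}` — the reflected complement, whence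
`𝔞_can = c•𝔞(Φ_w)·𝔭_w·𝔭_{c•w}⁻¹` (LA4-p03 02:29Z valuation table; not needed formally).

MAIN STATEMENTS.  §1 `ker_residue_restrict_comp_complexConj_eq_iff` (`τ∘c ↦ c•w ↔ τ ↦ w`), `signature_le_one_of_ker_eq_complexConj_smul` (`m ≤ 1` on the
`c•w`-block), **`mem_canType_iff_comp_complexConj_not_mem`** (`Φ′(m)` is a CM type), **`structural_mem_canType`** (`τ_w ∈ Φ′(m)`); §2 HEAD
**`exists_canonicalTwistIdeal_rows`** (`∃ 𝔞 = 𝔞_can-token, (p^f) = 𝔞·c•𝔞 ∧ (∀ N, p ∤ N → 𝔞 + (N) = (1)) ∧ 𝔞 ≠ 0 ∧ 𝔭_w ∣ 𝔞`) and the unpacked norm row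
**`span_pow_eq_canonicalTwistIdeal_mul_complexConj_smul`** (`twistNorm_spec` ∕ row (a) shape with `twistNorm := p ^ f`).

[cite: Shimura1998, §8.3 Prop. 29; §13.1 Theorem 1 (pp. 97–99) and (7)] [cite: RapoportSmithlingZhang2020Diagonal, §4.1 (4.6) p. 16 and p. 17]
[cite: NeukirchANT1999, Ch. II (8.1); Ch. III §1 (1.6) Prop. (iv)]
-/

set_option autoImplicit false

-- `Summit.HodgeConjecture.HodgeConjecture.…` repeats `HodgeConjecture` by design (D-0017).
set_option linter.dupNamespace false

noncomputable section

open NumberField IsDedekindDomain IsLocalRing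
open scoped Pointwise
open Literature.NumberTheory.GaloisRepresentations (closureValuationSubring)
open Literature.NumberTheory.Automorphic
open Summit.HodgeConjecture.HodgeConjecture.Theorems.F0P6aKottwitzCountAtSplitPlace
open Summit.HodgeConjecture.HodgeConjecture.Theorems.F0P6aEmbeddingTorsorPlaces
open Summit.HodgeConjecture.HodgeConjecture.Theorems.F0P6aFrobeniusTwistIdealAtSplitPlace

namespace Summit.HodgeConjecture.HodgeConjecture.Theorems.F0P6aCanonicalTwistIdealAsTypeNorm

variable {F : Type} [Field F] [NumberField F] [IsCMField F] (w : HeightOneSpectrum (𝓞 F))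
  (τR : (F →+* AlgebraicClosure (w.adicCompletion F)) → (𝓞 F →+* ↥(closureValuationSubring (w.adicCompletion F))))
  (hτR : ∀ (τ : F →+* AlgebraicClosure (w.adicCompletion F)) (x : 𝓞 F),
    ((τR τ x : ↥(closureValuationSubring (w.adicCompletion F))) : AlgebraicClosure (w.adicCompletion F)) = τ (x : F))
  (m : (F →+* AlgebraicClosure (w.adicCompletion F)) → ℕ)
  (hpair : ∀ τ : F →+* AlgebraicClosure (w.adicCompletion F),
    m τ + m (τ.comp ((IsCMField.complexConj F : F ≃ₐ[↥(maximalRealSubfield F)] F) : F →+* F)) = 2)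
  (hcount : ∑ τ ∈ (Finset.univ.filter fun τ : F →+* AlgebraicClosure (w.adicCompletion F) =>
      RingHom.ker ((residue ↥(closureValuationSubring (w.adicCompletion F))).comp (τR τ)) =
        (((IsCMField.complexConj F) • w).asIdeal : Ideal (𝓞 F))), m τ = 1)
  (hone : ∀ τ : F →+* AlgebraicClosure (w.adicCompletion F), m τ = 1 →
      RingHom.ker ((residue ↥(closureValuationSubring (w.adicCompletion F))).comp (τR τ)) = w.asIdeal ∨
        RingHom.ker ((residue ↥(closureValuationSubring (w.adicCompletion F))).comp (τR τ)) = ((IsCMField.complexConj F) • w).asIdeal)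

/-! ### §1 `Φ′(m) = {τ | m τ ≠ 0 ∧ τ ∤ c•w}` is a CM type through `τ_w` -/

include hτR in
/-- **`τ ∘ c` induces `c•w` iff `τ` induces `w`** (★ `ker_residue_restrict_comp_complexConj`: the prime induced by `τ ∘ c` is `c •` the prime induced by `τ`,
and `c • ·` is injective on ideals). [cite: NeukirchANT1999, Ch. II (8.1)] [cite: RapoportSmithlingZhang2020Diagonal, §3.2 p. 10] -/
theorem ker_residue_restrict_comp_complexConj_eq_iff (τ : F →+* AlgebraicClosure (w.adicCompletion F)) :
    RingHom.ker ((residue ↥(closureValuationSubring (w.adicCompletion F))).comp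
        (τR (τ.comp ((IsCMField.complexConj F : F ≃ₐ[↥(maximalRealSubfield F)] F) : F →+* F)))) =
          ((IsCMField.complexConj F) • w).asIdeal ↔
      RingHom.ker ((residue ↥(closureValuationSubring (w.adicCompletion F))).comp (τR τ)) = w.asIdeal := by
  rw [ker_residue_restrict_comp_complexConj w τR hτR τ, HeightOneSpectrum.smul_asIdeal, smul_left_cancel_iff]

include hcount in
/-- **On the `c•w`-block the signature is `≤ 1`** (one term of the count `∑_{τ ↦ c•w} m τ = 1`). [cite: RapoportSmithlingZhang2020Diagonal, §4.1 (4.6) p. 16] -/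
theorem signature_le_one_of_ker_eq_complexConj_smul (τ : F →+* AlgebraicClosure (w.adicCompletion F))
    (hτ : RingHom.ker ((residue ↥(closureValuationSubring (w.adicCompletion F))).comp (τR τ)) = ((IsCMField.complexConj F) • w).asIdeal) :
    m τ ≤ 1 := by
  classical
  have hmem : τ ∈ Finset.univ.filter fun τ : F →+* AlgebraicClosure (w.adicCompletion F) =>
      RingHom.ker ((residue ↥(closureValuationSubring (w.adicCompletion F))).comp (τR τ)) =
        (((IsCMField.complexConj F) • w).asIdeal : Ideal (𝓞 F)) :=
    Finset.mem_filter.mpr ⟨Finset.mem_univ _, hτ⟩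
  have hle := Finset.single_le_sum (f := m) (fun _ _ => Nat.zero_le _) hmem
  rwa [hcount] at hle

include hτR hpair hcount hone in
/-- **`Φ′(m)` IS A CM TYPE**: `τ ∈ Φ′(m) ↔ τ ∘ c ∉ Φ′(m)` for `Φ′(m) = {τ | m τ ≠ 0 ∧ τ ∤ c•w}`.  (→) if both `τ`, `τ∘c` had `m ≠ 0` then `m τ = m (τ∘c) = 1`
(`hpair`), so `τ` induces `w` or `c•w` (`hone`) — not `c•w` (`τ ∈ Φ′`), not `w` (else `τ∘c ↦ c•w ∉ Φ′`).  (←) if `m (τ∘c) = 0` then `m τ = 2`, and `τ ∤ c•w` since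
`m ≤ 1` on the `c•w`-block (`hcount`); if `τ∘c ↦ c•w` then `τ ↦ w ≠ c•w` and `m τ ≠ 0` (★ `signature_ne_zero_of_ker_eq`).
[cite: RapoportSmithlingZhang2020Diagonal, §3.2 p. 10; §4.1 (4.6) p. 16] [cite: Shimura1998, §13.1 Theorem 1 and (7)] -/
theorem mem_canType_iff_comp_complexConj_not_mem (hw : (IsCMField.complexConj F) • w ≠ w) (τ : F →+* AlgebraicClosure (w.adicCompletion F)) :
    τ ∈ Finset.univ.filter (fun τ : F →+* AlgebraicClosure (w.adicCompletion F) =>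
        m τ ≠ 0 ∧ RingHom.ker ((residue ↥(closureValuationSubring (w.adicCompletion F))).comp (τR τ)) ≠
          (((IsCMField.complexConj F) • w).asIdeal : Ideal (𝓞 F))) ↔
      τ.comp ((IsCMField.complexConj F : F ≃ₐ[↥(maximalRealSubfield F)] F) : F →+* F) ∉
        Finset.univ.filter (fun τ : F →+* AlgebraicClosure (w.adicCompletion F) =>
          m τ ≠ 0 ∧ RingHom.ker ((residue ↥(closureValuationSubring (w.adicCompletion F))).comp (τR τ)) ≠
            (((IsCMField.complexConj F) • w).asIdeal : Ideal (𝓞 F))) := by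
  simp only [Finset.mem_filter, Finset.mem_univ, true_and, not_and, not_not]
  have hp := hpair τ
  have hcc := ker_residue_restrict_comp_complexConj_eq_iff w τR hτR τ
  have hwne : (w.asIdeal : Ideal (𝓞 F)) ≠ ((IsCMField.complexConj F) • w).asIdeal := fun h => hw (HeightOneSpectrum.ext h).symm
  constructor
  · rintro ⟨hm, hcw⟩ hmc
    -- both signatures are non-zero, hence both `= 1`; `hone` puts `τ` on `w` or `c•w`
    have h1 : m τ = 1 := by omega
    rcases hone τ h1 with hτw | hτcw
    · exact hcc.mpr hτw
    · exact absurd hτcw hcw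
  · intro h
    by_cases hmc : m (τ.comp ((IsCMField.complexConj F : F ≃ₐ[↥(maximalRealSubfield F)] F) : F →+* F)) = 0
    · refine ⟨by omega, fun hτcw => ?_⟩
      have := signature_le_one_of_ker_eq_complexConj_smul w τR m hcount τ hτcw
      omega
    · have hτw : RingHom.ker ((residue ↥(closureValuationSubring (w.adicCompletion F))).comp (τR τ)) = w.asIdeal := hcc.mp (h hmc)
      exact ⟨signature_ne_zero_of_ker_eq w τR hτR m hpair hcount τ hτw, fun h' => hwne (hτw.symm.trans h')⟩

include hτR hpair hcount in
/-- **`τ_w ∈ Φ′(m)`**: the structural embedding induces `w ≠ c•w` (★ `ker_residue_restrict_structural`) and carries `m ≠ 0` (★ `signature_ne_zero_of_ker_eq`).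
[cite: RapoportSmithlingZhang2020Diagonal, §4.1 (4.6) p. 16 and p. 17] -/
theorem structural_mem_canType (hw : (IsCMField.complexConj F) • w ≠ w) :
    (algebraMap (w.adicCompletion F) (AlgebraicClosure (w.adicCompletion F))).comp (algebraMap F (w.adicCompletion F)) ∈
      Finset.univ.filter (fun τ : F →+* AlgebraicClosure (w.adicCompletion F) =>
        m τ ≠ 0 ∧ RingHom.ker ((residue ↥(closureValuationSubring (w.adicCompletion F))).comp (τR τ)) ≠
          (((IsCMField.complexConj F) • w).asIdeal : Ideal (𝓞 F))) := by
  rw [Finset.mem_filter]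
  refine ⟨Finset.mem_univ _, signature_ne_zero_of_ker_eq w τR hτR m hpair hcount _ (ker_residue_restrict_structural w τR hτR), ?_⟩
  rw [ker_residue_restrict_structural w τR hτR]
  exact fun h => hw (HeightOneSpectrum.ext h).symm

/-! ### §2 HEAD: the rows of `𝔞_can(m, τR, w)` as a type product (★ p847929 at `Φ := Φ′(m)`) -/

include hτR hpair hcount hone in
/-- **THE CANONICAL TWIST IDEAL SATISFIES THE E-SIDE ROWS** (one application of ★ `exists_frobeniusTwistIdeal` to the CM type `Φ′(m)`): with
`𝔞 := 𝔞_can(m, τR, w) = ∏ τ ∈ univ.filter (m τ ≠ 0 ∧ ker (residue ∘ τR τ) ≠ 𝔭_{c•w}), ker (residue ∘ τR τ)` (TOKEN of ★ p847883), `p` the residue characteristic of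
`w` and `N 𝔭_{c•w} = p ^ f` (the spread՚s `hpChar`, `hfDeg`): (a) `(p^f) = 𝔞 · c•𝔞`, (b) `𝔞 + (N) = (1)` for `p ∤ N`, (c) `𝔞 ≠ 0`, (FROB-𝔞) `𝔭_w ∣ 𝔞` — the rows of
`ETwistAt` ∕ `PELTwistLawAt` at a Frobenius-reading `γ_σ` with `twistIdeal γ_σ := 𝔞_can`, `twistNorm γ_σ := p ^ f`, in the same token as the D-line՚s pin
`twistIdeal_frob_eq`. [cite: Shimura1998, §8.3 Prop. 29; §13.1 Theorem 1 (pp. 97–99) and (7)] [cite: RapoportSmithlingZhang2020Diagonal, §4.1 (4.6) p. 16 and p. 17] -/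
theorem exists_canonicalTwistIdeal_rows [IsGalois ℚ F] (hw : (IsCMField.complexConj F) • w ≠ w)
    {p f : ℕ} (hp : p.Prime) (hpw : (p : 𝓞 F) ∈ w.asIdeal) (hf : Nat.card (𝓞 F ⧸ ((IsCMField.complexConj F) • w).asIdeal) = p ^ f) :
    ∃ 𝔞 : Ideal (𝓞 F),
      𝔞 = ∏ τ ∈ Finset.univ.filter (fun τ : F →+* AlgebraicClosure (w.adicCompletion F) =>
          m τ ≠ 0 ∧ RingHom.ker ((residue ↥(closureValuationSubring (w.adicCompletion F))).comp (τR τ)) ≠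
            (((IsCMField.complexConj F) • w).asIdeal : Ideal (𝓞 F))),
        RingHom.ker ((residue ↥(closureValuationSubring (w.adicCompletion F))).comp (τR τ)) ∧
      Ideal.span {((p ^ f : ℕ) : 𝓞 F)} = 𝔞 * (IsCMField.complexConj F) • 𝔞 ∧
      (∀ N : ℕ, ¬ p ∣ N → 𝔞 ⊔ Ideal.span {((N : ℕ) : 𝓞 F)} = ⊤) ∧
      𝔞 ≠ ⊥ ∧ w.asIdeal ∣ 𝔞 :=
  exists_frobeniusTwistIdeal w τR hτR _ (structural_mem_canType w τR hτR m hpair hcount hw)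
    (mem_canType_iff_comp_complexConj_not_mem w τR hτR m hpair hcount hone hw) hp hpw hf

include hτR hpair hcount hone in
/-- **ROW (a) ∕ `twistNorm_spec` UNPACKED for the token**: `Ideal.span {((p ^ f : ℕ) : 𝓞 F)} = 𝔞_can * c • 𝔞_can`.
[cite: Shimura1998, §8.3 Prop. 29; §13.1 Theorem 1 and (7)] [cite: NeukirchANT1999, Ch. III §1 (1.6) Prop. (iv)] -/
theorem span_pow_eq_canonicalTwistIdeal_mul_complexConj_smul [IsGalois ℚ F] (hw : (IsCMField.complexConj F) • w ≠ w)
    {p f : ℕ} (hf : Nat.card (𝓞 F ⧸ ((IsCMField.complexConj F) • w).asIdeal) = p ^ f) :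
    Ideal.span {((p ^ f : ℕ) : 𝓞 F)} =
      (∏ τ ∈ Finset.univ.filter (fun τ : F →+* AlgebraicClosure (w.adicCompletion F) =>
          m τ ≠ 0 ∧ RingHom.ker ((residue ↥(closureValuationSubring (w.adicCompletion F))).comp (τR τ)) ≠
            (((IsCMField.complexConj F) • w).asIdeal : Ideal (𝓞 F))),
        RingHom.ker ((residue ↥(closureValuationSubring (w.adicCompletion F))).comp (τR τ))) *
      (IsCMField.complexConj F) •
        ∏ τ ∈ Finset.univ.filter (fun τ : F →+* AlgebraicClosure (w.adicCompletion F) =>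
          m τ ≠ 0 ∧ RingHom.ker ((residue ↥(closureValuationSubring (w.adicCompletion F))).comp (τR τ)) ≠
            (((IsCMField.complexConj F) • w).asIdeal : Ideal (𝓞 F))),
        RingHom.ker ((residue ↥(closureValuationSubring (w.adicCompletion F))).comp (τR τ)) :=
  span_pow_eq_prod_mul_complexConj_smul_prod w τR hτR _ (mem_canType_iff_comp_complexConj_not_mem w τR hτR m hpair hcount hone hw) hf

end Summit.HodgeConjecture.HodgeConjecture.Theorems.F0P6aCanonicalTwistIdealAsTypeNorm

end
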